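import Summits.AtomisticToContinuum.BoseEinsteinCondensation.Theses.BECInfraredBound
import Mathlib.MeasureTheory.Group.Integral

/-!
# Kernel-level load-bearing witnesses for `BECInfraredBound.BecDepletionCounting`

Negative lemmas (refuter lane, `--supports stmt-AtomisticToContinuum-9034`).

The crux `BecDepletionCounting` (`X_B3c`) is an implication
`depletion hypothesis (X_B3a) → shell hypothesis (X_B3b) → zero-mode thesis (X_B1')`, all three
evaluated on the same class of near-minimisers.  Its proof (crux workfile
`Cruxes/BecDepletionCounting/TranslateTracedParsevalProof.lean`) is a *per-state* counting
inequality `n₀(Ψ) ≥ N_{Λ'}(Ψ) − D(Ψ) − N·‖φ₀|_{Λ'} − φ'_0‖²`.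

This file records, as kernel-checked theorems, that at the level of individual admissible states
**both hypotheses are load-bearing**: for every box `Λ_L` and every margin `ε` there are admissible
(normalised, `C¹`, Dirichlet) one-particle states with

* `shellHyp_loadBearing` — inner depletion `0` (every mode supported in the inner cube `Λ'` has
  occupation `0`), yet zero-mode occupation `0` and shell mass `= N`: dropping the shell
  hypothesis from the per-state counting is impossible;
* `depletionHyp_loadBearing` — shell mass `0`, yet zero-mode occupation `0`; the state lives in
  `Λ'` and is orthogonal to the inner constant mode `φ'_0`, so (by the inner Parseval identity
  `InnerSumRule`) its inner depletion is all of `N`: dropping the depletion hypothesis is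
  impossible.

The witnesses are odd bump states `Ψ(X) = k · (x₁ − c₁) · f(X)` (`f` a `ContDiffBump` centred at
`c`, odd reflection `x ↦ 2c − x` kills the pairing with every mode constant on the bump's ball).
At the crux level the corresponding hypothesis-dropped statements are *implied* by the route
target `BecZeroModeThesis` (see the cdisprove work file `Cruxes/BecDepletionCounting/Disproof.lean`),
so no crux-level `_false_without_` theorem exists short of refuting the route; these kernel-level
witnesses are the sharpest unconditional form of "any proof must use both hypotheses". [folklore]
-/

noncomputable section

open MeasureTheory Metric
open scoped ENNReal NNReal ComplexConjugate

namespace Summit.AtomisticToContinuum.BoseEinsteinCondensation.Theorems.BecDepletionCounting.Negative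

open Literature.MathematicalPhysics.QuantumManyBody.BoseGas

/-! ## Normalising a real one-particle profile -/

/-- A `C¹`, compactly supported, not identically vanishing real profile on `Config 1`, vanishing
off the box, normalises to an admissible one-particle trial state `X ↦ k · g X`. [folklore] -/
theorem exists_trialState_of_profile {L : ℝ} (g : Config 1 → ℝ) (hg : ContDiff ℝ 1 g)
    (hgc : HasCompactSupport g) (hbox : ∀ X, X ∉ boxN 1 L → g X = 0) (hne : ∃ X, g X ≠ 0) :
    ∃ (k : ℝ≥0) (Ψ : TrialState 1 L), ∀ X, Ψ.ψ X = (k : ℂ) * (g X : ℂ) := by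
  have hcont : Continuous g := hg.continuous
  set A : ℝ≥0∞ := ∫⁻ X, (‖g X‖₊ : ℝ≥0∞) ^ 2 with hA
  have hmeas : Measurable (fun X => (‖g X‖₊ : ℝ≥0∞) ^ 2) :=
    (hcont.measurable.nnnorm.coe_nnreal_ennreal).pow_const 2
  -- finiteness
  have hAtop : A ≠ ⊤ := by
    have hint : Integrable (fun X => g X * g X) volume :=
      (hcont.mul hcont).integrable_of_hasCompactSupport (hgc.mul_left (f := g))
    have := hint.2
    rw [HasFiniteIntegral] at this
    refine ne_top_of_le_ne_top this.ne (le_of_eq ?_)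
    refine lintegral_congr fun X => ?_
    rw [enorm_mul, sq]
    rfl
  -- positivity (by continuity: a vanishing integral forces `g ≡ 0`)
  have hA0 : A ≠ 0 := by
    intro hA0
    have hae := (lintegral_eq_zero_iff hmeas).1 hA0
    have hc2 : Continuous (fun X => (‖g X‖₊ : ℝ≥0∞) ^ 2) :=
      (ENNReal.continuous_pow 2).comp (ENNReal.continuous_coe.comp (continuous_nnnorm.comp hcont))
    have heq := (Continuous.ae_eq_iff_eq volume hc2 continuous_const).1 hae
    obtain ⟨X, hX⟩ := hne
    have h0 : (‖g X‖₊ : ℝ≥0∞) ^ 2 = 0 := congrFun heq X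
    have : g X = 0 := by simpa using h0
    exact hX this
  let k : ℝ≥0 := NNReal.sqrt (A.toNNReal)⁻¹
  have hk : (k : ℝ≥0∞) ^ 2 * A = 1 := by
    rw [← ENNReal.coe_pow, NNReal.sq_sqrt, ENNReal.coe_inv (ENNReal.toNNReal_ne_zero.2 ⟨hA0, hAtop⟩),
      ENNReal.coe_toNNReal hAtop, ENNReal.inv_mul_cancel hA0 hAtop]
  refine ⟨k, ⟨fun X => (k : ℂ) * (g X : ℂ), ?_, ?_, ?_, ?_⟩, fun X => rfl⟩
  · exact contDiff_const.mul (Complex.ofRealCLM.contDiff.comp hg)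
  · intro X hX
    simp [hbox X hX]
  · intro σ X
    rw [Subsingleton.elim σ 1, Equiv.Perm.coe_one, Function.comp_id]
  · have : ∀ X, (‖(k : ℂ) * (g X : ℂ)‖₊ : ℝ≥0∞) ^ 2 = (k : ℝ≥0∞) ^ 2 * (‖g X‖₊ : ℝ≥0∞) ^ 2 := by
      intro X
      rw [nnnorm_mul, ENNReal.coe_mul, mul_pow]
      congr 2
      · simp
      · rw [Complex.nnnorm_real]
    simp_rw [this]
    rw [lintegral_const_mul _ hmeas, hk]

/-! ## The odd bump state -/

/-- **Odd bump states.** For every centre `c` and radius `r > 0` with `B(c, r) ⊆ Λ_L` there is an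
admissible one-particle trial state supported in `{X | X 0 ∈ B(c, r)}` whose one-particle
integral vanishes identically.  It is `X ↦ k · (X 0 1 − c 1) · f(X)` with `f` a `ContDiffBump` of
radii `r/2, r` centred at `fun _ => c`; the point reflection `x ↦ 2c − x` flips its sign.
[folklore] -/
theorem exists_oddBumpState {L : ℝ} (c : Space) {r : ℝ} (hr : 0 < r)
    (hbox : ∀ x : Space, dist x c < r → x ∈ box L) :
    ∃ Ψ : TrialState 1 L,
      (∀ X : Config 1, r ≤ dist (X 0) c → Ψ.ψ X = 0) ∧
      (∀ Y : Config 0, ∫ x, Ψ.ψ (Matrix.vecCons x Y) = 0) := by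
  -- the bump and the odd profile
  let f : ContDiffBump (fun _ : Fin 1 => c : Config 1) := ⟨r / 2, r, by positivity, by linarith⟩
  let g : Config 1 → ℝ := fun X => (X 0 1 - c 1) * f X
  have hg_smooth : ContDiff ℝ 1 g :=
    ((((EuclideanSpace.proj (1 : Fin 3) : Space →L[ℝ] ℝ).contDiff).comp
      (contDiff_apply ℝ Space (0 : Fin 1))).sub contDiff_const).mul f.contDiff
  have hg_supp : HasCompactSupport g := f.hasCompactSupport.mul_left
  -- the profile vanishes once the particle is at distance `≥ r` from the centre
  have hg_zero : ∀ X : Config 1, r ≤ dist (X 0) c → g X = 0 := by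
    intro X hX
    have hf : f X = 0 := by
      rw [← Function.notMem_support, f.support_eq]
      intro hball
      have h1 : dist (X 0) c < r := (dist_le_pi_dist X (fun _ : Fin 1 => c) 0).trans_lt hball
      exact lt_irrefl _ (h1.trans_le hX)
    simp [g, hf]
  -- oddness under the point reflection of the particle coordinate
  have hg_reflect : ∀ (x : Space) (Y : Config 0),
      g (Matrix.vecCons (c + c - x) Y) = -g (Matrix.vecCons x Y) := by
    intro x Y
    have h1 : (Matrix.vecCons (c + c - x) Y : Config 1) =
        (fun _ : Fin 1 => c) - (Matrix.vecCons x Y - fun _ : Fin 1 => c) := by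
      funext i
      fin_cases i
      simp only [Fin.zero_eta, Matrix.cons_val_zero, Pi.sub_apply]
      abel
    have hf : f (Matrix.vecCons (c + c - x) Y) = f (Matrix.vecCons x Y) := by
      rw [h1, ContDiffBump.sub]
      congr 1
      funext i
      fin_cases i
      simp
    simp only [g, Matrix.cons_val_zero, hf, PiLp.sub_apply, PiLp.add_apply]
    ring
  -- the profile does not vanish identically
  have hg_ne : ∃ X, g X ≠ 0 := by
    refine ⟨fun _ => c + EuclideanSpace.single 1 (r / 2), ?_⟩
    have hball : (fun _ : Fin 1 => c + EuclideanSpace.single 1 (r / 2) : Config 1) ∈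
        ball (fun _ : Fin 1 => c : Config 1) f.rOut := by
      rw [mem_ball, dist_pi_const, dist_eq_norm, add_sub_cancel_left, PiLp.norm_single,
        Real.norm_eq_abs, abs_of_pos (by positivity)]
      show r / 2 < r
      linarith
    have hpos := f.pos_of_mem_ball hball
    have hlin : (c + EuclideanSpace.single (1 : Fin 3) (r / 2)) 1 - c 1 = r / 2 := by
      simp
    simp only [g, hlin]
    exact mul_ne_zero (by positivity) hpos.ne'
  -- normalise
  have hboxN : ∀ X : Config 1, X ∉ boxN 1 L → g X = 0 := by
    intro X hX
    apply hg_zero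
    by_contra hlt
    exact hX fun i => by rw [Subsingleton.elim i 0]; exact hbox _ (not_le.1 hlt)
  obtain ⟨k, Ψ, hΨ⟩ := exists_trialState_of_profile g hg_smooth hg_supp hboxN hg_ne
  refine ⟨Ψ, fun X hX => by rw [hΨ, hg_zero X hX]; simp, fun Y => ?_⟩
  have hodd : ∀ x, Ψ.ψ (Matrix.vecCons (c + c - x) Y) = -Ψ.ψ (Matrix.vecCons x Y) := by
    intro x
    rw [hΨ, hΨ, hg_reflect, Complex.ofReal_neg, mul_neg]
  have hI : ∫ x, Ψ.ψ (Matrix.vecCons x Y) = -∫ x, Ψ.ψ (Matrix.vecCons x Y) := by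
    conv_lhs => rw [← integral_sub_left_eq_self (fun x => Ψ.ψ (Matrix.vecCons x Y)) volume (c + c)]
    simp only [hodd, integral_neg]
  linear_combination hI / 2

/-- **Occupation of modes constant on the bump's ball vanishes.** For an odd bump state and any
mode `φ` constant on `B(c, r)` (in particular `φ ≡ 0` there), `N ∫|⟨φ, Ψ⟩_x|² dX = 0`. -/
theorem occupation_eq_zero_of_const_on_ball {L : ℝ} {c : Space} {r : ℝ} (Ψ : TrialState 1 L)
    (h1 : ∀ X : Config 1, r ≤ dist (X 0) c → Ψ.ψ X = 0)
    (h2 : ∀ Y : Config 0, ∫ x, Ψ.ψ (Matrix.vecCons x Y) = 0)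
    (φ : Space → ℂ) (a : ℂ) (hφ : ∀ x, dist x c < r → φ x = a) :
    occupation 1 φ Ψ.ψ = 0 := by
  have key : ∀ Y : Config 0, ∫ x, conj (φ x) * Ψ.ψ (Matrix.vecCons x Y) = 0 := by
    intro Y
    have hpt : (fun x => conj (φ x) * Ψ.ψ (Matrix.vecCons x Y)) =
        fun x => conj a * Ψ.ψ (Matrix.vecCons x Y) := by
      funext x
      by_cases hx : dist x c < r
      · rw [hφ x hx]
      · rw [h1 _ (by simpa using not_lt.1 hx), mul_zero, mul_zero]
    rw [hpt, integral_const_mul, h2 Y, mul_zero]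
  simp only [occupation, key, nnnorm_zero, ENNReal.coe_zero, ne_eq, OfNat.ofNat_ne_zero,
    not_false_eq_true, zero_pow, lintegral_const, zero_mul, mul_zero]

/-! ## The two load-bearing witnesses

`Λ' = {x | ∀ j, x j ∈ (εL, L − εL)}` is written out exactly as in the crux (with `L` for
`sideLength ρ N`). -/

/-- **The shell hypothesis `X_B3b` is load-bearing (kernel level).** For every box side `L > 0`
and margin `0 < ε < 1` there is an admissible one-particle state whose inner depletion vanishes
identically — every mode supported in the inner cube `Λ'` (in particular every `φ'_k`, `k ≠ 0`,
of the crux) has occupation `0`, so the depletion hypothesis holds for every `θ ≥ 0` — whose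
zero-mode occupation `n₀ = N ∫|⟨φ₀, Ψ⟩|²` nevertheless vanishes, all of its mass sitting in the
shell `Λ ∖ Λ'` (shell mass `= 1 = N`: the shell hypothesis fails as soon as `Cε < 1`).  Hence the
per-state counting behind `BecDepletionCounting` cannot dispense with the shell hypothesis.
Witness: the odd bump state around `(εL/2, L/2, L/2)` of radius `εL/4`. [folklore] -/
theorem shellHyp_loadBearing {L ε : ℝ} (hL : 0 < L) (hε : 0 < ε) (hε1 : ε < 1) :
    ∃ Ψ : TrialState 1 L,
      (∀ g : Space → ℂ,
        occupation 1 ({x : Space | ∀ j, x j ∈ Set.Ioo (ε * L) (L - ε * L)}.indicator g) Ψ.ψ = 0) ∧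
      (∑' k : {k : Fin 3 → ℤ // k ≠ 0}, occupation 1
        ({x : Space | ∀ j, x j ∈ Set.Ioo (ε * L) (L - ε * L)}.indicator fun x =>
          ((Real.sqrt (((1 - 2 * ε) * L) ^ 3))⁻¹ : ℂ) *
            Complex.exp (Complex.I * ↑(2 * Real.pi / ((1 - 2 * ε) * L) *
              ∑ j, (k.1 j : ℝ) * x j))) Ψ.ψ) = 0 ∧
      occupation 1 ((box L).indicator fun _ => ((Real.sqrt (L ^ 3))⁻¹ : ℂ)) Ψ.ψ = 0 ∧
      ∑ i : Fin 1, ∫⁻ X, {x : Space | ∀ j, x j ∈ Set.Ioo (ε * L) (L - ε * L)}ᶜ.indicator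
          (fun _ => (1 : ℝ≥0∞)) (X i) * (‖Ψ.ψ X‖₊ : ℝ≥0∞) ^ 2 = 1 := by
  -- centre `(εL/2, L/2, L/2)`, radius `εL/4`
  set c : Space := WithLp.toLp 2 (fun j : Fin 3 => if j = 0 then ε * L / 2 else L / 2) with hc
  have hc0 : c 0 = ε * L / 2 := by simp [hc]
  have hcj : ∀ j : Fin 3, j ≠ 0 → c j = L / 2 := fun j hj => by simp [hc, hj]
  have hr : 0 < ε * L / 4 := by positivity
  have hεL : ε * L < L := by nlinarith
  have hball : ∀ x : Space, dist x c < ε * L / 4 →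
      (ε * L / 4 < x 0 ∧ x 0 < 3 * (ε * L) / 4) ∧
        ∀ j : Fin 3, j ≠ 0 → (L / 4 < x j ∧ x j < 3 * L / 4) := by
    intro x hx
    have hxj : ∀ j, |x j - c j| < ε * L / 4 := fun j => by
      have := (PiLp.dist_apply_le x c j).trans_lt hx
      rwa [Real.dist_eq] at this
    refine ⟨?_, fun j hj => ?_⟩
    · have := hxj 0
      rw [hc0, abs_lt] at this
      constructor <;> linarith [this.1, this.2]
    · have := hxj j
      rw [hcj j hj, abs_lt] at this
      constructor <;> linarith [this.1, this.2]
  have hbox : ∀ x : Space, dist x c < ε * L / 4 → x ∈ box L := by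
    intro x hx k
    by_cases hk : k = 0
    · subst hk
      have := (hball x hx).1
      constructor <;> linarith [this.1, this.2]
    · have := (hball x hx).2 k hk
      constructor <;> linarith [this.1, this.2]
  have houter : ∀ x : Space, dist x c < ε * L / 4 →
      x ∉ {x : Space | ∀ j, x j ∈ Set.Ioo (ε * L) (L - ε * L)} := by
    intro x hx hx'
    have h1 := (hball x hx).1.2
    have h2 := (hx' 0).1
    linarith
  obtain ⟨Ψ, h1, h2⟩ := exists_oddBumpState c hr hbox
  have hinner : ∀ g : Space → ℂ,
      occupation 1 ({x : Space | ∀ j, x j ∈ Set.Ioo (ε * L) (L - ε * L)}.indicator g) Ψ.ψ = 0 :=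
    fun g => occupation_eq_zero_of_const_on_ball Ψ h1 h2 _ 0
      fun x hx => Set.indicator_of_notMem (houter x hx) _
  refine ⟨Ψ, hinner, by simp only [hinner, tsum_zero], ?_, ?_⟩
  · exact occupation_eq_zero_of_const_on_ball Ψ h1 h2 _ _
      fun x hx => Set.indicator_of_mem (hbox x hx) _
  · rw [Fin.sum_univ_one]
    refine (lintegral_congr fun X => ?_).trans Ψ.norm_eq
    by_cases hX : X 0 ∈ {x : Space | ∀ j, x j ∈ Set.Ioo (ε * L) (L - ε * L)}
    · have hfar : ε * L / 4 ≤ dist (X 0) c := not_lt.1 fun hlt => houter _ hlt hX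
      rw [h1 X hfar]
      simp
    · rw [Set.indicator_of_mem (Set.mem_compl hX), one_mul]

/-- **The depletion hypothesis `X_B3a` is load-bearing (kernel level).** For `L > 0` and
`0 < ε < 1/4` there is an admissible one-particle state with shell mass `0` (it lives in
`B((L/2)𝟙, L/8) ⊆ Λ'`, so the shell hypothesis holds for every `C ≥ 0`) whose zero-mode
occupation nevertheless vanishes; it is orthogonal to the inner constant mode `φ'_0` and carries
all of its mass in `Λ'`, so by the inner Parseval identity (`InnerSumRule`) its inner depletion
`∑_{k≠0} N|⟨φ'_k, Ψ⟩|²` is all of `N_{Λ'} = N` (the depletion hypothesis fails for every `θ < 1`).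
Hence the per-state counting behind `BecDepletionCounting` cannot dispense with the depletion
hypothesis.  Witness: the odd bump state around the centre of the box, radius `L/8`. [folklore] -/
theorem depletionHyp_loadBearing {L ε : ℝ} (hL : 0 < L) (hε : 0 < ε) (hε4 : ε < 1 / 4) :
    ∃ Ψ : TrialState 1 L,
      ∑ i : Fin 1, ∫⁻ X, {x : Space | ∀ j, x j ∈ Set.Ioo (ε * L) (L - ε * L)}ᶜ.indicator
          (fun _ => (1 : ℝ≥0∞)) (X i) * (‖Ψ.ψ X‖₊ : ℝ≥0∞) ^ 2 = 0 ∧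
      occupation 1 ((box L).indicator fun _ => ((Real.sqrt (L ^ 3))⁻¹ : ℂ)) Ψ.ψ = 0 ∧
      (∀ a : ℂ, occupation 1
        ({x : Space | ∀ j, x j ∈ Set.Ioo (ε * L) (L - ε * L)}.indicator fun _ => a) Ψ.ψ = 0) ∧
      ∫⁻ X, {x : Space | ∀ j, x j ∈ Set.Ioo (ε * L) (L - ε * L)}.indicator
          (fun _ => (1 : ℝ≥0∞)) (X 0) * (‖Ψ.ψ X‖₊ : ℝ≥0∞) ^ 2 = 1 := by
  set c : Space := WithLp.toLp 2 (fun _ : Fin 3 => L / 2) with hc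
  have hcj : ∀ j : Fin 3, c j = L / 2 := fun j => by simp [hc]
  have hr : 0 < L / 8 := by positivity
  have hball : ∀ x : Space, dist x c < L / 8 → ∀ j, 3 * L / 8 < x j ∧ x j < 5 * L / 8 := by
    intro x hx j
    have := (PiLp.dist_apply_le x c j).trans_lt hx
    rw [Real.dist_eq, hcj, abs_lt] at this
    constructor <;> linarith [this.1, this.2]
  have hinner : ∀ x : Space, dist x c < L / 8 →
      x ∈ {x : Space | ∀ j, x j ∈ Set.Ioo (ε * L) (L - ε * L)} := by
    intro x hx j
    have := hball x hx j
    constructor <;> nlinarith [this.1, this.2]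
  have hbox : ∀ x : Space, dist x c < L / 8 → x ∈ box L := by
    intro x hx k
    have := hball x hx k
    constructor <;> linarith [this.1, this.2]
  obtain ⟨Ψ, h1, h2⟩ := exists_oddBumpState c hr hbox
  have hfar : ∀ X : Config 1, X 0 ∉ {x : Space | ∀ j, x j ∈ Set.Ioo (ε * L) (L - ε * L)} →
      L / 8 ≤ dist (X 0) c :=
    fun X hX => not_lt.1 fun hlt => hX (hinner _ hlt)
  refine ⟨Ψ, ?_, ?_, fun a => ?_, ?_⟩
  · rw [Fin.sum_univ_one]
    refine (lintegral_congr fun X => ?_).trans (lintegral_zero (μ := volume))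
    by_cases hX : X 0 ∈ {x : Space | ∀ j, x j ∈ Set.Ioo (ε * L) (L - ε * L)}
    · rw [Set.indicator_of_notMem (fun h => (Set.mem_compl_iff _ _).1 h hX), zero_mul]
    · rw [h1 X (hfar X hX)]
      simp
  · exact occupation_eq_zero_of_const_on_ball Ψ h1 h2 _ _
      fun x hx => Set.indicator_of_mem (hbox x hx) _
  · exact occupation_eq_zero_of_const_on_ball Ψ h1 h2 _ a
      fun x hx => Set.indicator_of_mem (hinner x hx) _
  · refine (lintegral_congr fun X => ?_).trans Ψ.norm_eq
    by_cases hX : X 0 ∈ {x : Space | ∀ j, x j ∈ Set.Ioo (ε * L) (L - ε * L)}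
    · rw [Set.indicator_of_mem hX, one_mul]
    · rw [h1 X (hfar X hX)]
      simp

end Summit.AtomisticToContinuum.BoseEinsteinCondensation.Theorems.BecDepletionCounting.Negative

end
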